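import Summits.Ventures.LatticeQCDFlow.Scaling.OneSidedHubFloor
import Summits.Ventures.LatticeQCDFlow.Scaling.FlowSamplerTunnelingTime
import Literature.Probability.MarkovChains.CovarianceDecay
import Literature.Probability.MarkovChains.SpectralProfileComparison

/-!
HONEST FRAMING: exact (Metropolis-corrected) sampling algorithms for lattice gauge theory; figures
of merit are autocorrelation/cost numbers at stated couplings and volumes; no continuum-physics
claim.

# ExchangeOfferCeiling — THE OFFER CEILING: AN EXCHANGE SCHEME `t·GSw_e + (1−t)·prodKernel w M` OVER ANY SWAP GRAPH
# (IDENTITY MAPS) RELAXES REPLICA `k` NO FASTER THAN ITS SWAP PARTNERS OFFER EACH CONFIGURATION: FOR EVERY LEVEL `k` AND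
# CONFIGURATION `u`, `Gap ≤ ((t/m)·Σ_{edges (i,k)} μ_i(u) + (1−t)·w_k·μ_k(u))/(μ_k(u)(1 − μ_k(u)))`; THE STAR: COLD LEVEL
# `Gap ≤ (t·μ_0(u)/K + (1−t)w_{k+1}μ_{k+1}(u))/(μ_{k+1}(u)(1−μ_{k+1}(u)))`, AND WITH `Scaling/OneSidedHubFloor` THE
# HOT-ONLY STAR OBEYS `p·min{t, γ₀(1−t)}/(14K) ≤ Gap ≤ 2t·(μ_0(u)/μ_{k+1}(u))/K` (`μ_{k+1}(u) ≤ ½`) — THE ONE-SIDED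
# DOMINATION RATIO IS THE RATE (lean-2 GEN-22, ours)

Venture-side (OURS).  Cell `lqcd-flow` (pub-lqcd), unit `pub-lqcd-lean-2-g22`, 2026-08-26.  Chapter J, file 10: a
POINTWISE ceiling complementing the sector / cut / common-mode ceilings of chapters Z, G, H
(`Scaling/ExchangeSchemeSectorCeiling`, `…CutCeiling`, `…CommonModeCeiling`) and the converse of
`Scaling/OneSidedHubFloor` (J8).  Test function: the indicator of "replica `k` sits at `u`".  Its Dirichlet form is
the stationary exit flow from that event; a Metropolis graph swap leaves it only through an edge incident to `k` and
only by bringing the partner's configuration, and by `π̃(x)GSw(x,y) = T(x,y)·min{π̃(x),π̃(y)} ≤ T(y,x)·π̃(y)` the swap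
part of the exit flow is at most `(1/m)·Σ_{edges (i,k)} μ_i(u)` — the partners' weight of `u`; the update part is at
most `w_kμ_k(u)`.  Setting: swap graph `e` of `m` edges with distinct endpoints, identity maps, weights `w ≥ 0`,
`Σw = 1`, `0 ≤ t ≤ 1`, `M_k` row-stochastic `μ_k`-reversible, `|S| ≥ 2`.

## What is proved

* §1 `sum_ptGraphProposal_into_level` (`Σ_{x : x_k = u} T(y,x) ≤ (1/m)·Σ_r offer_r(y)` for `y_k ≠ u`),
  **`exchange_exitFlow_le`** (`Q({x_k = u}, ·ᶜ) ≤ (t/m)·Σ_{(i,k) ∈ e} μ_i(u) + (1−t)·w_k·μ_k(u)`), `pointMass_lt_one`.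
* §2 **`exchange_spectralGap_le_offer`** — the offer ceiling above, every `k`, `u`.
* §3 the star: **`weightedStar_spectralGap_le_config`** (cold level `k+1`: offer `μ_0(u)`),
  **`hotOnlyStar_spectralGap_le_config`** (`Gap ≤ t·μ_0(u)/(K·μ_{k+1}(u)(1−μ_{k+1}(u)))`),
  **`oneSidedHotOnlyStar_twoSided_domination`** (with J8: `p·min{t,γ₀(1−t)}/(14K) ≤ Gap ≤ 2t·(μ_0(u)/μ_{k+1}(u))/K` for
  `μ_{k+1}(u) ≤ ½`; `p` may be taken `min_{k,u} μ_0(u)/μ_{k+1}(u)`).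

Reading (no numerics implied): a hub is exactly as fast, per replica, as the worst hot-to-cold weight ratio of a
single configuration allows (within `min{t,γ₀(1−t)}/(14t)` and `2`); a ladder trades this global ratio for adjacent
ratios at the price of the `K³` law; maps change the laws the ratio is taken of (conjugate by
`Scaling/FlowHubSchemeFloor`), not the statement.  NOT CLAIMED: the map versions spelled out; anything measured.
Literature grade (cell rule): ELEMENTARY (indicator test function; Levin–Peres Remark 13.8, `Var(1_A)`, `𝓔(1_A)` PROVED
in the tree), NEW TYPING; nothing cited as a fact; no new bib keys.
-/

noncomputable section

open Finset Function
open Literature.Probability.MarkovChains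

namespace Summit.Ventures.LatticeQCDFlow.Scaling

section Offer

variable {S : Type*} [Fintype S] [DecidableEq S] {K m : ℕ} {μ : Fin (K + 1) → S → ℝ}
  {M : Fin (K + 1) → S → S → ℝ} {w : Fin (K + 1) → ℝ} {t : ℝ} {e : Fin m → Fin (K + 1) × Fin (K + 1)}

/-! ## §1 The exit flow from "replica `k` sits at `u`" -/

/-- **The graph proposal from outside into the event:** for `y` with `y_k ≠ u` (edges with distinct endpoints),
`Σ_{x : x_k = u} T(y, x) ≤ (1/m)·Σ_r (if k = i_r then [y_{l_r} = u] else if k = l_r then [y_{i_r} = u] else 0)`. [ours] -/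
theorem sum_ptGraphProposal_into_level (he : ∀ r, (e r).1 ≠ (e r).2) (k : Fin (K + 1)) (u : S)
    {y : Fin (K + 1) → S} (hy : y k ≠ u) :
    ∑ x ∈ univ.filter (fun x : Fin (K + 1) → S => x k = u), ptGraphProposal e (fun _ : Fin m => Equiv.refl S) y x
      ≤ (1 : ℝ) / m * ∑ r, (if k = (e r).1 then (if y (e r).2 = u then (1 : ℝ) else 0)
          else if k = (e r).2 then (if y (e r).1 = u then (1 : ℝ) else 0) else 0) := by
  unfold ptGraphProposal
  rw [sum_comm, mul_sum]
  refine sum_le_sum fun r _ => ?_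
  rw [sum_filter]
  have e1 : ∀ x : Fin (K + 1) → S, (if x k = u then
      (if x = edgeFlowSwap (Equiv.refl S) (e r).1 (e r).2 y then (1 : ℝ) / m else 0) else 0)
      = if x = edgeFlowSwap (Equiv.refl S) (e r).1 (e r).2 y then
          (if (edgeFlowSwap (Equiv.refl S) (e r).1 (e r).2 y) k = u then (1 : ℝ) / m else 0) else 0 := by
    intro x
    by_cases hx : x = edgeFlowSwap (Equiv.refl S) (e r).1 (e r).2 y
    · subst hx; simp
    · simp [hx]
  simp_rw [e1]
  rw [sum_ite_eq' univ, if_pos (mem_univ _), edgeFlowSwap_one (he r)]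
  have hval : (y ∘ Equiv.swap (e r).1 (e r).2) k
      = if k = (e r).1 then y (e r).2 else if k = (e r).2 then y (e r).1 else y k := by
    simp only [Function.comp_apply, Equiv.swap_apply_def]
    split_ifs <;> rfl
  rw [hval]
  by_cases h1 : k = (e r).1
  · rw [if_pos h1, if_pos h1]
    by_cases h3 : y (e r).2 = u
    · rw [if_pos h3, if_pos h3, mul_one]
    · rw [if_neg h3, if_neg h3, mul_zero]
  · by_cases h2 : k = (e r).2
    · rw [if_neg h1, if_neg h1, if_pos h2, if_pos h2]
      by_cases h3 : y (e r).1 = u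
      · rw [if_pos h3, if_pos h3, mul_one]
      · rw [if_neg h3, if_neg h3, mul_zero]
    · rw [if_neg h1, if_neg h1, if_neg h2, if_neg h2, if_neg hy, mul_zero]

/-- A positive probability vector on a nontrivial space gives every point mass `< 1`. [ours] -/
theorem pointMass_lt_one [Nontrivial S] {ν : S → ℝ} (hν : ∀ v, 0 < ν v) (hν1 : ∑ v, ν v = 1) (u : S) : ν u < 1 := by
  obtain ⟨v, hv⟩ := exists_ne u
  have h2 : ν u + ν v ≤ ∑ x, ν x := by
    rw [← sum_pair (Ne.symm hv)]
    exact sum_le_sum_of_subset_of_nonneg (subset_univ _) fun x _ _ => (hν x).le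
  linarith [hν v]

/-- **THE EXIT FLOW FROM `A = {x : x_k = u}`:**
`Q(A, Aᶜ) ≤ (t/m)·Σ_r (if k = i_r then μ_{l_r}(u) else if k = l_r then μ_{i_r}(u) else 0) + (1−t)·w_k·μ_k(u)`. [ours] -/
theorem exchange_exitFlow_le (he : ∀ r, (e r).1 ≠ (e r).2) (hμ : ∀ k x, 0 < μ k x) (hμ1 : ∀ k, ∑ u, μ k u = 1)
    (hM : ∀ k, IsRowStochastic (M k)) (hw0 : ∀ k, 0 ≤ w k) (ht0 : 0 ≤ t) (ht1 : t ≤ 1) (k : Fin (K + 1)) (u : S) :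
    edgeMeasure (tensorFun μ) (fun x y : Fin (K + 1) → S =>
        t * ptGraphSwap μ e (fun _ : Fin m => Equiv.refl S) x y + (1 - t) * prodKernel w M x y)
        (univ.filter (fun x : Fin (K + 1) → S => x k = u)) (univ.filter (fun x : Fin (K + 1) → S => x k = u))ᶜ
      ≤ t / m * ∑ r, (if k = (e r).1 then μ (e r).2 u else if k = (e r).2 then μ (e r).1 u else 0)
        + (1 - t) * w k * μ k u := by
  set A := univ.filter (fun x : Fin (K + 1) → S => x k = u) with hA
  have hAc : ∀ y, y ∈ Aᶜ ↔ y k ≠ u := fun y => by rw [hA, mem_compl, mem_filter]; simp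
  have hπ0 : ∀ x, 0 ≤ tensorFun μ x := fun x => (tensorFun_pos hμ x).le
  -- level masses `Σ_y [y_j = u]·π̃(y) = μ_j(u)`
  have hlevel : ∀ j : Fin (K + 1), ∑ y : Fin (K + 1) → S, tensorFun μ y * (if y j = u then (1 : ℝ) else 0) = μ j u := by
    intro j
    have h := tensorFun_mass_levelSector (μ := μ) hμ1 j ({u} : Finset S)
    rw [sum_singleton, sum_filter] at h
    simp only [mem_singleton] at h
    rw [← h]
    exact sum_congr rfl fun y _ => by split_ifs <;> simp
  unfold edgeMeasure
  simp_rw [mul_add, sum_add_distrib]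
  refine add_le_add ?_ ?_
  · -- the swap part
    have step1 : ∀ x ∈ A, ∀ y ∈ Aᶜ, tensorFun μ x * (t * ptGraphSwap μ e (fun _ : Fin m => Equiv.refl S) x y)
        ≤ t * (tensorFun μ y * ptGraphProposal e (fun _ : Fin m => Equiv.refl S) y x) := by
      intro x hx y hy
      have hyx : y ≠ x := by
        intro h; rw [h] at hy; exact ((hAc x).mp hy) (by rw [hA, mem_filter] at hx; exact hx.2)
      have h := tensorFun_mul_ptGraphSwap (e := e) (φ := fun _ : Fin m => Equiv.refl S) hμ he hyx
      calc tensorFun μ x * (t * ptGraphSwap μ e (fun _ : Fin m => Equiv.refl S) x y)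
          = t * (ptGraphProposal e (fun _ : Fin m => Equiv.refl S) x y * min (tensorFun μ x) (tensorFun μ y)) := by
            rw [← h]; ring
        _ ≤ t * (ptGraphProposal e (fun _ : Fin m => Equiv.refl S) x y * tensorFun μ y) :=
            mul_le_mul_of_nonneg_left (mul_le_mul_of_nonneg_left (min_le_right _ _)
              (ptGraphProposal_nonneg e _ x y)) ht0
        _ = t * (tensorFun μ y * ptGraphProposal e (fun _ : Fin m => Equiv.refl S) y x) := by
            rw [ptGraphProposal_symm he]; ring
    set offer : (Fin (K + 1) → S) → ℝ := fun y => ∑ r, (if k = (e r).1 then (if y (e r).2 = u then (1 : ℝ) else 0)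
      else if k = (e r).2 then (if y (e r).1 = u then (1 : ℝ) else 0) else 0) with hoffer
    have hoffer0 : ∀ y, 0 ≤ offer y := fun y => sum_nonneg fun r _ => by
      split_ifs <;> norm_num
    calc ∑ x ∈ A, ∑ y ∈ Aᶜ, tensorFun μ x * (t * ptGraphSwap μ e (fun _ : Fin m => Equiv.refl S) x y)
        ≤ ∑ x ∈ A, ∑ y ∈ Aᶜ, t * (tensorFun μ y * ptGraphProposal e (fun _ : Fin m => Equiv.refl S) y x) :=
          sum_le_sum fun x hx => sum_le_sum fun y hy => step1 x hx y hy
      _ = t * ∑ y ∈ Aᶜ, tensorFun μ y * ∑ x ∈ A, ptGraphProposal e (fun _ : Fin m => Equiv.refl S) y x := by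
          rw [sum_comm, mul_sum]
          exact sum_congr rfl fun y _ => by rw [mul_sum, mul_sum]
      _ ≤ t * ∑ y ∈ Aᶜ, tensorFun μ y * ((1 : ℝ) / m * offer y) := by
          refine mul_le_mul_of_nonneg_left (sum_le_sum fun y hy => ?_) ht0
          exact mul_le_mul_of_nonneg_left (sum_ptGraphProposal_into_level he k u ((hAc y).mp hy)) (hπ0 y)
      _ ≤ t * ∑ y, tensorFun μ y * ((1 : ℝ) / m * offer y) :=
          mul_le_mul_of_nonneg_left (sum_le_sum_of_subset_of_nonneg (subset_univ _)
            fun y _ _ => mul_nonneg (hπ0 y) (mul_nonneg (by positivity) (hoffer0 y))) ht0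
      _ = t / m * ∑ r, (if k = (e r).1 then μ (e r).2 u else if k = (e r).2 then μ (e r).1 u else 0) := by
          have e3 : ∑ y, tensorFun μ y * ((1 : ℝ) / m * offer y) = (1 : ℝ) / m * ∑ r, ∑ y : Fin (K + 1) → S,
              tensorFun μ y * (if k = (e r).1 then (if y (e r).2 = u then (1 : ℝ) else 0)
                else if k = (e r).2 then (if y (e r).1 = u then (1 : ℝ) else 0) else 0) := by
            rw [sum_comm, mul_sum]
            refine sum_congr rfl fun y _ => ?_
            rw [hoffer, mul_sum, mul_sum, mul_sum]
            exact sum_congr rfl fun r _ => by ring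
          have e4 : ∑ r, ∑ y : Fin (K + 1) → S,
              tensorFun μ y * (if k = (e r).1 then (if y (e r).2 = u then (1 : ℝ) else 0)
                else if k = (e r).2 then (if y (e r).1 = u then (1 : ℝ) else 0) else 0)
              = ∑ r, (if k = (e r).1 then μ (e r).2 u else if k = (e r).2 then μ (e r).1 u else 0) := by
            refine sum_congr rfl fun r _ => ?_
            by_cases h1 : k = (e r).1
            · simp only [if_pos h1]; exact hlevel (e r).2
            · by_cases h2 : k = (e r).2
              · simp only [if_neg h1, if_pos h2]; exact hlevel (e r).1
              · simp only [if_neg h1, if_neg h2, mul_zero, sum_const_zero]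
          rw [e3, e4]
          ring
  · -- the update part
    have step2 : ∀ x ∈ A, ∑ y ∈ Aᶜ, prodKernel w M x y ≤ w k := by
      intro x hx
      have hxu : x k = u := by rw [hA, mem_filter] at hx; exact hx.2
      set G : (Fin (K + 1) → S) → ℝ := fun y => if y k = u then 0 else 1 with hG
      have e1 : ∑ y ∈ Aᶜ, prodKernel w M x y = ∑ y, prodKernel w M x y * G y := by
        rw [hA, compl_filter, sum_filter]
        refine sum_congr rfl fun y _ => ?_
        by_cases hy : y k = u
        · simp [hG, hy]
        · simp [hG, hy]
      have e2 : ∑ y, prodKernel w M x y * G y = ∑ j, w j * ∑ v, M j (x j) v * G (update x j v) := by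
        simp_rw [prodKernel_apply, sum_mul]
        rw [sum_comm]
        refine sum_congr rfl fun j _ => ?_
        rw [← sum_coordKernel_mul M j x G, mul_sum]
        exact sum_congr rfl fun y _ => by ring
      have e3 : ∀ j : Fin (K + 1), ∑ v, M j (x j) v * G (update x j v) ≤ if j = k then 1 else 0 := by
        intro j
        by_cases hj : j = k
        · subst hj
          rw [if_pos rfl]
          calc ∑ v, M j (x j) v * G (update x j v) ≤ ∑ v, M j (x j) v := by
                refine sum_le_sum fun v _ => ?_
                have hGle : G (update x j v) ≤ 1 := by simp only [hG]; split_ifs <;> norm_num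
                calc M j (x j) v * G (update x j v) ≤ M j (x j) v * 1 :=
                      mul_le_mul_of_nonneg_left hGle ((hM j).1 _ _)
                  _ = _ := mul_one _
            _ = 1 := (hM j).2 _
        · rw [if_neg hj]
          refine le_of_eq (sum_eq_zero fun v _ => ?_)
          have : G (update x j v) = 0 := by
            simp only [hG]; rw [update_of_ne (Ne.symm hj), if_pos hxu]
          rw [this, mul_zero]
      rw [e1, e2]
      calc ∑ j, w j * ∑ v, M j (x j) v * G (update x j v) ≤ ∑ j, w j * (if j = k then (1 : ℝ) else 0) :=
            sum_le_sum fun j _ => mul_le_mul_of_nonneg_left (e3 j) (hw0 j)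
        _ = w k := by simp
    have hmass : ∑ x ∈ A, tensorFun μ x = μ k u := by
      rw [← hlevel k, hA, sum_filter]
      exact sum_congr rfl fun y _ => by split_ifs <;> simp
    calc ∑ x ∈ A, ∑ y ∈ Aᶜ, tensorFun μ x * ((1 - t) * prodKernel w M x y)
        = ∑ x ∈ A, (1 - t) * tensorFun μ x * ∑ y ∈ Aᶜ, prodKernel w M x y := by
          refine sum_congr rfl fun x _ => ?_
          rw [mul_sum]; exact sum_congr rfl fun y _ => by ring
      _ ≤ ∑ x ∈ A, (1 - t) * tensorFun μ x * w k :=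
          sum_le_sum fun x hx => mul_le_mul_of_nonneg_left (step2 x hx) (mul_nonneg (by linarith) (hπ0 x))
      _ = (1 - t) * w k * μ k u := by rw [← sum_mul, ← mul_sum, hmass]; ring

/-! ## §2 The offer ceiling -/

/-- **THE OFFER CEILING:** for every level `k` and configuration `u`,
`Gap(P) ≤ ((t/m)·Σ_r (if k = i_r then μ_{l_r}(u) else if k = l_r then μ_{i_r}(u) else 0) + (1−t)·w_k·μ_k(u))
          / (μ_k(u)(1 − μ_k(u)))` — an exchange scheme relaxes replica `k` no faster than its swap partners offer
`u`. [ours] -/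
theorem exchange_spectralGap_le_offer [Nontrivial S] (he : ∀ r, (e r).1 ≠ (e r).2) (hμ : ∀ k x, 0 < μ k x)
    (hμ1 : ∀ k, ∑ u, μ k u = 1) (hM : ∀ k, IsRowStochastic (M k)) (hMrev : ∀ k, DetailedBalance (μ k) (M k))
    (hw0 : ∀ k, 0 ≤ w k) (hw1 : ∑ k, w k = 1) (ht0 : 0 ≤ t) (ht1 : t ≤ 1) (k : Fin (K + 1)) (u : S) :
    spectralGap (tensorFun μ) (fun x y : Fin (K + 1) → S =>
        t * ptGraphSwap μ e (fun _ : Fin m => Equiv.refl S) x y + (1 - t) * prodKernel w M x y)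
      ≤ (t / m * ∑ r, (if k = (e r).1 then μ (e r).2 u else if k = (e r).2 then μ (e r).1 u else 0)
          + (1 - t) * w k * μ k u) / (μ k u * (1 - μ k u)) := by
  set A := univ.filter (fun x : Fin (K + 1) → S => x k = u) with hA
  have hPst := weightedScheme_isRowStochastic (t := t) (w := w)
    (ptGraphSwap_isRowStochastic (e := e) (φ := fun _ : Fin m => Equiv.refl S) hμ) hM hw0 hw1 ht0 ht1
  have hDB := weightedScheme_detailedBalance (w := w)
    (ptGraphSwap_detailedBalance (e := e) (φ := fun _ : Fin m => Equiv.refl S) hμ) hMrev t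
  have hmass : ∑ x ∈ A, tensorFun μ x = μ k u := by
    have h := tensorFun_mass_levelSector (μ := μ) hμ1 k ({u} : Finset S)
    rw [sum_singleton] at h
    have hA' : univ.filter (fun x : Fin (K + 1) → S => x k ∈ ({u} : Finset S)) = A := by
      rw [hA]; congr 1; funext x; simp
    rwa [hA'] at h
  have hlt : μ k u < 1 := pointMass_lt_one (hμ k) (hμ1 k) u
  have hV : 0 < μ k u * (1 - μ k u) := mul_pos (hμ _ _) (by linarith)
  have hray := LevinPeres2017_remark_13_8 (tensorFun_pos hμ) (sum_tensorFun_eq_one μ hμ1) hPst hDB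
    (fun x => if x ∈ A then (1 : ℝ) else 0)
  have hhalf : ∀ a : ℝ, (1 : ℝ) / 2 * (a + a) = a := fun a => by ring
  rw [lawVariance_setIndicator (sum_tensorFun_eq_one μ hμ1), dirichletForm_setIndicator, hmass,
    ← edgeMeasure_compl_comm hPst (hDB.isStationary hPst.2), hhalf] at hray
  have hQ := exchange_exitFlow_le (M := M) (w := w) he hμ hμ1 hM hw0 ht0 ht1 k u
  rw [le_div_iff₀ hV]
  exact hray.trans hQ

/-! ## §3 The star: the one-sided domination ratio is the rate -/

omit [Fintype S] [DecidableEq S] in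
/-- The offer of a cold level `k+1` on the star is the hot weight. [ours] -/
theorem star_offer_succ (μ : Fin (K + 1) → S → ℝ) (k : Fin K) (u : S) :
    ∑ r : Fin K, (if (k.succ : Fin (K + 1)) = ((fun r : Fin K => (((0 : Fin (K + 1)), r.succ) : Fin (K + 1) × Fin (K + 1))) r).1
        then μ ((fun r : Fin K => (((0 : Fin (K + 1)), r.succ) : Fin (K + 1) × Fin (K + 1))) r).2 u
        else if (k.succ : Fin (K + 1)) = ((fun r : Fin K => (((0 : Fin (K + 1)), r.succ) : Fin (K + 1) × Fin (K + 1))) r).2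
        then μ ((fun r : Fin K => (((0 : Fin (K + 1)), r.succ) : Fin (K + 1) × Fin (K + 1))) r).1 u else 0)
      = μ 0 u := by
  simp only [Fin.succ_ne_zero, if_false, Fin.succ_inj]
  rw [sum_ite_eq univ k, if_pos (mem_univ k)]

/-- **THE WEIGHTED STAR, COLD LEVEL `k+1`:**
`Gap ≤ (t·μ_0(u)/K + (1−t)·w_{k+1}·μ_{k+1}(u))/(μ_{k+1}(u)(1 − μ_{k+1}(u)))`. [ours] -/
theorem weightedStar_spectralGap_le_config [Nontrivial S] (hμ : ∀ k x, 0 < μ k x) (hμ1 : ∀ k, ∑ u, μ k u = 1)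
    (hM : ∀ k, IsRowStochastic (M k)) (hMrev : ∀ k, DetailedBalance (μ k) (M k)) (hw0 : ∀ k, 0 ≤ w k)
    (hw1 : ∑ k, w k = 1) (ht0 : 0 ≤ t) (ht1 : t ≤ 1) (k : Fin K) (u : S) :
    spectralGap (tensorFun μ) (fun x y : Fin (K + 1) → S =>
        t * ptGraphSwap μ (fun k : Fin K => ((0 : Fin (K + 1)), k.succ)) (fun _ : Fin K => Equiv.refl S) x y
          + (1 - t) * prodKernel w M x y)
      ≤ (t * μ 0 u / K + (1 - t) * w k.succ * μ k.succ u) / (μ k.succ u * (1 - μ k.succ u)) := by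
  have h := exchange_spectralGap_le_offer (e := fun k : Fin K => ((0 : Fin (K + 1)), k.succ)) (w := w)
    (fun r => (Fin.succ_ne_zero r).symm) hμ hμ1 hM hMrev hw0 hw1 ht0 ht1 k.succ u
  rw [star_offer_succ μ k u] at h
  rw [show t * μ 0 u / K = t / K * μ 0 u by ring]
  exact h

/-- **HOT-ONLY UPDATES:** `Gap ≤ t·μ_0(u)/(K·μ_{k+1}(u)·(1 − μ_{k+1}(u)))` for every cold level and configuration. [ours] -/
theorem hotOnlyStar_spectralGap_le_config [Nontrivial S] (hμ : ∀ k x, 0 < μ k x) (hμ1 : ∀ k, ∑ u, μ k u = 1)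
    (hM : ∀ k, IsRowStochastic (M k)) (hMrev : ∀ k, DetailedBalance (μ k) (M k)) (ht0 : 0 ≤ t) (ht1 : t ≤ 1)
    (k : Fin K) (u : S) :
    spectralGap (tensorFun μ) (fun x y : Fin (K + 1) → S =>
        t * ptGraphSwap μ (fun k : Fin K => ((0 : Fin (K + 1)), k.succ)) (fun _ : Fin K => Equiv.refl S) x y
          + (1 - t) * prodKernel (fun k : Fin (K + 1) => if k = 0 then (1 : ℝ) else 0) M x y)
      ≤ t * μ 0 u / (K * (μ k.succ u * (1 - μ k.succ u))) := by
  have hw0 : ∀ k : Fin (K + 1), 0 ≤ (if k = 0 then (1 : ℝ) else 0) := fun k => by positivity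
  have h := weightedStar_spectralGap_le_config (w := fun k : Fin (K + 1) => if k = 0 then (1 : ℝ) else 0) hμ hμ1 hM
    hMrev hw0 hotOnlyWeight_sum ht0 ht1 k u
  rw [if_neg (Fin.succ_ne_zero k), mul_zero, zero_mul, add_zero, div_div] at h
  exact h

/-- **THE ONE-SIDED DOMINATION RATIO IS THE RATE (hot-only star):** with `p·μ_{k+1} ≤ μ_0` pointwise (`0 < p ≤ 1`),
hot Poincaré constant `γ₀`, `0 < t < 1`, `K ≥ 1`: for every cold level `k+1` and configuration `u` with
`μ_{k+1}(u) ≤ ½`, **`p·min{t, γ₀(1−t)}/(14K) ≤ Gap(P) ≤ 2t·(μ_0(u)/μ_{k+1}(u))/K`**. [ours] -/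
theorem oneSidedHotOnlyStar_twoSided_domination [Nontrivial S] (hK : 1 ≤ K) (hμ : ∀ k x, 0 < μ k x)
    (hμ1 : ∀ k, ∑ u, μ k u = 1) (hM : ∀ k, IsRowStochastic (M k)) (hMrev : ∀ k, DetailedBalance (μ k) (M k))
    (ht0 : 0 < t) (ht1 : t < 1) {p γ₀ : ℝ} (hp : 0 < p) (hp1 : p ≤ 1) (hγ₀ : 0 < γ₀)
    (hdom : ∀ (k : Fin K) (u : S), p * μ k.succ u ≤ μ 0 u)
    (hgap0 : ∀ h : S → ℝ, γ₀ * lawVariance (μ 0) h ≤ dirichletForm (μ 0) (M 0) h)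
    (k : Fin K) {u : S} (hu : μ k.succ u ≤ 1 / 2) :
    p * min t (γ₀ * (1 - t)) / (14 * K)
        ≤ spectralGap (tensorFun μ) (fun x y : Fin (K + 1) → S =>
            t * ptGraphSwap μ (fun k : Fin K => ((0 : Fin (K + 1)), k.succ)) (fun _ : Fin K => Equiv.refl S) x y
              + (1 - t) * prodKernel (fun k : Fin (K + 1) => if k = 0 then (1 : ℝ) else 0) M x y)
      ∧ spectralGap (tensorFun μ) (fun x y : Fin (K + 1) → S =>
            t * ptGraphSwap μ (fun k : Fin K => ((0 : Fin (K + 1)), k.succ)) (fun _ : Fin K => Equiv.refl S) x y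
              + (1 - t) * prodKernel (fun k : Fin (K + 1) => if k = 0 then (1 : ℝ) else 0) M x y)
          ≤ 2 * t * (μ 0 u / μ k.succ u) / K := by
  have hKr : (1 : ℝ) ≤ K := by exact_mod_cast hK
  have hKpos : (0 : ℝ) < K := by linarith
  have hw0 : ∀ k : Fin (K + 1), 0 ≤ (if k = 0 then (1 : ℝ) else 0) := fun k => by positivity
  refine ⟨?_, ?_⟩
  · have h := oneSidedHub_spectralGap_ge (e := fun k : Fin K => ((0 : Fin (K + 1)), k.succ))
      (w := fun k : Fin (K + 1) => if k = 0 then (1 : ℝ) else 0) hK hK (fun k => (Fin.succ_ne_zero k).symm)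
      (fun k => ⟨k, rfl⟩) hμ hμ1 hM hMrev hw0 hotOnlyWeight_sum (by simp) ht0 ht1 hp hp1 hγ₀ hdom hgap0
    simp only [if_true, mul_one] at h
    refine le_trans ?_ h
    rw [show p * min t (γ₀ * (1 - t)) / (14 * K) = p * (min t (γ₀ * (1 - t)) / (14 * K)) by ring]
    refine mul_le_mul_of_nonneg_left (le_min ?_ ?_) hp.le
    · calc min t (γ₀ * (1 - t)) / (14 * K) ≤ t / (14 * K) :=
            div_le_div_of_nonneg_right (min_le_left _ _) (by positivity)
        _ ≤ t / (6 * K) := div_le_div_of_nonneg_left ht0.le (by positivity) (by nlinarith)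
    · exact div_le_div_of_nonneg_right (min_le_right _ _) (by positivity)
  · have h := hotOnlyStar_spectralGap_le_config (M := M) hμ hμ1 hM hMrev ht0.le ht1.le k u
    refine h.trans ?_
    have hμu : 0 < μ k.succ u := hμ _ _
    have h1 : 1 / 2 ≤ 1 - μ k.succ u := by linarith
    rw [div_le_div_iff₀ (mul_pos hKpos (mul_pos hμu (by linarith))) hKpos]
    have e : 2 * t * (μ 0 u / μ k.succ u) * (K * (μ k.succ u * (1 - μ k.succ u)))
        = t * μ 0 u * K * (2 * (1 - μ k.succ u)) := by
      field_simp
    rw [e]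
    have : (1 : ℝ) ≤ 2 * (1 - μ k.succ u) := by linarith
    calc t * μ 0 u * K = t * μ 0 u * K * 1 := (mul_one _).symm
      _ ≤ t * μ 0 u * K * (2 * (1 - μ k.succ u)) :=
          mul_le_mul_of_nonneg_left this (by have := (hμ 0 u).le; positivity)

end Offer

end Summit.Ventures.LatticeQCDFlow.Scaling

end
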